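import Summits.BirchSwinnertonDyer.Rank1Residual.GaloisImage.UnramifiedCocycleIdentityComponent
import Summits.BirchSwinnertonDyer.Rank1Residual.GaloisImage.CubicRootStabilizer
import Summits.BirchSwinnertonDyer.Rank1Residual.GaloisImage.CongruenceVisibilityTwistedWitnessDischarge
import Literature.NumberTheory.EllipticCurves.FormalGroupKummerPointProofs
import HarnessLib

/-!
# THEOREM A: the unramified cubic twist of an identity-component `3`-torsion point is principal
# (cell `b2b-bsdres`, team n1011, seat p10 GEN 8; THEOREM A programme, FILE 7d; note
# `HOME/b2b-bsdres-n1011-p10/g8/L41-NOTE.md` §1, plan `g8/THEOREM-A-PLAN.md`)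

HONEST FRAMING (cell `b2b-bsdres`, run/shared/lean/b2b/bsd-rank1-residual/, verbatim in every
file): the goal of the cell is to DELETE the COMBINATION-SHAPED residual classes of the
Birch–Swinnerton-Dyer formula for ALL analytic-rank `≤ 1` elliptic curves over `ℚ` — "full BSD
formula for every rank `≤ 1` curve in class `C`" assembled STRICTLY from published theorems — so
that the rank-`≤ 1` remainder becomes exactly the CONSTRUCTION-SHAPED classes, which are TYPED
(missing-input `Prop`s), NOT attempted. This is not "finishing BSD". Team n1011 (N10 / N11):
research route on the CONSTRUCTION-SHAPED class X4 (§I N11 LOWER half); no claim beyond the stated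
classes; nothing is booked; marks UNCHANGED. Theorems only: no definition, no named fact, no
`sorry`. TOOL theorems; they close nothing by themselves.

## What

THEOREM A of the note, in the cocycle currency of FILES 7a–7c. Setting: `K` a number field, `v`
a place above `3`, `M` an integral Weierstrass model over `𝓞_v` (elliptic over `K_v`) whose
reduction is the cuspidal singular model `singularModel x₀ y₀ a a` (additive reduction),
`V = (M ⊗ K_v) ⊗ K̄_v`, `α ∈ K̄_v` with `α³ = α + 1` (so `K_v(α)/K_v` is the unramified cubic
extension when `X³ − X − 1` has no root in `K_v`, `−23` is a square and `−3` a non-square — FILE 4),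
`F₀ ∈ Γ_{K_v}` moving `α`, and `T = (a₀, b₀)` an INTEGRAL point of `M` with NONSINGULAR reduction
and `3 • T = O` in `V` (a `3`-torsion point of the identity component `E₀(K_v)`).

* `smul_cubicRoot_eq_of_mem_inertia` — the inertia group fixes `α` (the three roots of
  `X³ − X − 1` are mutually incongruent modulo `𝔪_w`: their differences multiply to `δ`,
  `δ² = −23`, a unit above `3`).
* `exists_map_sub_eq_twist_of_identityComponent` (**THEOREM A**) — there is `P ∈ V(K̄_v)` with
  `h P = P` for every `h ∈ Stab(α)` and `F₀ P − P = T`. Equivalently: the unramified class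
  `χ_α ∪ T ∈ H¹(K_v, E[3])` (`χ_α` the character of `K_v(α)/K_v` with `χ_α(F₀) = 1`) is the
  Kummer class of `3 • P ∈ E(K_v)`, i.e. lies in the local Kummer condition. Proof: the crossed
  homomorphism `g(σ) = i(σ) • T` (`σ ∈ F₀^{i(σ)} Stab(α)`, FILE 2 `exists_pow_mul_of_index_eq_prime`)
  is continuous (zero set `= Stab(α)`, open), vanishes on inertia (first bullet) and takes the
  values `O, T, −T`, all images of `E₀(K_v)`-points; FILE 7c makes it principal.

References: [MilneADT2006] I.3.8; [SilvermanAEC2009] VII.2.1, VIII.§2 (Kummer pairing);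
Lang–Tate 1958. The statement for `T ∉ E₀` is FALSE (L41-NOTE §7 (a)).
-/

noncomputable section

open scoped Classical NNReal Topology
open NumberField IsDedekindDomain Field Polynomial

namespace Summit.BirchSwinnertonDyer.Rank1Residual.GaloisImage.TwistedWitness

open WeierstrassCurve Literature.NumberTheory.EllipticCurves Literature.NumberTheory.EllipticCurves.FormalGroupChart
  Literature.NumberTheory.GaloisRepresentations
  Literature.NumberTheory.GaloisRepresentations.IsNonarchimedeanLocalField IsDedekindDomain.HeightOneSpectrum

variable {K : Type} [Field K] [NumberField K] {v : HeightOneSpectrum (𝓞 K)}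
  {w : Valuation (AlgebraicClosure (v.adicCompletion K)) ℝ≥0}
  (hw : ∀ x, (w x : ℝ) = spectralNorm (v.adicCompletion K) (AlgebraicClosure (v.adicCompletion K)) x)

/-! ## The inertia group fixes the roots of `X³ − X − 1` above `3` -/

section Inertia

include hw in
/-- A root of `X³ = X + 1` in `K̄_v` is a `w`-integer. [folklore] -/
theorem spectralValuation_le_one_of_cube {β : AlgebraicClosure (v.adicCompletion K)}
    (hβ : β ^ 3 = β + 1) : w β ≤ 1 := by
  have _ := hw
  by_contra h
  rw [not_le] at h
  have h1 : w (β + 1) ≤ w β := by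
    refine (Valuation.map_add w β 1).trans ?_
    rw [Valuation.map_one]
    exact max_le le_rfl h.le
  have h2 : w (β ^ 3) = w β ^ 3 := Valuation.map_pow w β 3
  rw [hβ] at h2
  have h3 : w β ^ 3 ≤ w β := h2 ▸ h1
  have h4 : w β < w β ^ 3 := by
    calc w β = w β * 1 * 1 := by ring
      _ < w β * w β * w β := by gcongr
      _ = w β ^ 3 := by ring
  exact absurd h3 (not_le.mpr h4)

include hw in
/-- **The inertia group fixes every root `α` of `X³ − X − 1`** at a place above `3` (where
`−23 = δ²` in `K_v`): the differences of the three roots multiply to `±δ`, a `v`-adic unit, so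
the roots are pairwise incongruent modulo `𝔪_w`, while an element of inertia moves `α` to a
root congruent to `α`. [folklore] -/
theorem smul_cubicRoot_eq_of_mem_inertia (h3v : ((3 : ℕ) : 𝓞 K) ∈ v.asIdeal)
    {𝔐 : Ideal v.localAbsIntegers} (h𝔐 : 𝔐 ∈ v.localPrimesAbove)
    {α : AlgebraicClosure (v.adicCompletion K)} (hα : α ^ 3 = α + 1)
    {δ : v.adicCompletion K} (hδ : δ ^ 2 = -23)
    {τ : absoluteGaloisGroup (v.adicCompletion K)}
    (hτ : τ ∈ 𝔐.inertia (absoluteGaloisGroup (v.adicCompletion K))) : τ • α = α := by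
  haveI : Fact (Nat.Prime 3) := ⟨Nat.prime_three⟩
  haveI : CharZero (v.adicCompletion K) := Literature.NumberTheory.GaloisRepresentations.charZero_adicCompletion v
  haveI : CharZero (AlgebraicClosure (v.adicCompletion K)) :=
    charZero_of_injective_algebraMap (algebraMap (v.adicCompletion K) _).injective
  have hαw : w α ≤ 1 := spectralValuation_le_one_of_cube hw hα
  -- the other two roots and their integrality
  set s : AlgebraicClosure (v.adicCompletion K) :=
    algebraMap (v.adicCompletion K) (AlgebraicClosure (v.adicCompletion K)) δ / (3 * α ^ 2 - 1) with hsdef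
  have hs2 : s ^ 2 = 4 - 3 * α ^ 2 := cubicRoot_s_sq hα hδ
  have hroot : ∀ r : AlgebraicClosure (v.adicCompletion K),
      r = (-α + s) / 2 ∨ r = (-α - s) / 2 → r ^ 3 = r + 1 := by
    rintro r (rfl | rfl)
    · have := cubic_factor hα hδ ((-α + s) / 2)
      rw [← hsdef] at this
      have h0 : ((-α + s) / 2) ^ 3 - (-α + s) / 2 - 1 = 0 := by rw [this]; ring
      linear_combination h0
    · have := cubic_factor hα hδ ((-α - s) / 2)
      rw [← hsdef] at this
      have h0 : ((-α - s) / 2) ^ 3 - (-α - s) / 2 - 1 = 0 := by rw [this]; ring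
      linear_combination h0
  have hrpw : w ((-α + s) / 2) ≤ 1 := spectralValuation_le_one_of_cube hw (hroot _ (Or.inl rfl))
  have hrmw : w ((-α - s) / 2) ≤ 1 := spectralValuation_le_one_of_cube hw (hroot _ (Or.inr rfl))
  -- `|δ| = 1`
  have h23 : w ((23 : ℕ) : AlgebraicClosure (v.adicCompletion K)) = 1 :=
    spectralValuation_natCast_eq_one_of_not_dvd (p := 3) h3v hw (by norm_num)
  have hδw : w (algebraMap (v.adicCompletion K) (AlgebraicClosure (v.adicCompletion K)) δ) = 1 := by
    have h2 : w (algebraMap (v.adicCompletion K) (AlgebraicClosure (v.adicCompletion K)) δ) ^ 2 = 1 := by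
      rw [← Valuation.map_pow, ← map_pow, hδ, map_neg, Valuation.map_neg, map_ofNat]
      exact_mod_cast h23
    exact (pow_eq_one_iff.mp h2).resolve_right (by norm_num)
  -- the product of the root differences is `δ`
  have hprod : (α - (-α + s) / 2) * (α - (-α - s) / 2) * ((-α + s) / 2 - (-α - s) / 2) =
      algebraMap (v.adicCompletion K) (AlgebraicClosure (v.adicCompletion K)) δ := by
    have hne := cubicRoot_deriv_ne_zero hα
    have e1 : (α - (-α + s) / 2) * (α - (-α - s) / 2) = 3 * α ^ 2 - 1 := by
      linear_combination (-1 / 4 : AlgebraicClosure (v.adicCompletion K)) * hs2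
    have e2 : (-α + s) / 2 - (-α - s) / 2 = s := by ring
    rw [e1, e2, hsdef, mul_div_cancel₀ _ hne]
  -- each difference is a unit
  have hdiff : ∀ x y : AlgebraicClosure (v.adicCompletion K), w x ≤ 1 → w y ≤ 1 → w (x - y) ≤ 1 :=
    fun x y hx hy ↦ (Valuation.map_sub w x y).trans (max_le hx hy)
  have hd1 := hdiff _ _ hαw hrpw
  have hd2 := hdiff _ _ hαw hrmw
  have hd3 := hdiff _ _ hrpw hrmw
  have hunit1 : w (α - (-α + s) / 2) = 1 := by
    by_contra hne
    have hlt : w (α - (-α + s) / 2) < 1 := lt_of_le_of_ne hd1 hne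
    have := congrArg w hprod
    rw [Valuation.map_mul, Valuation.map_mul, hδw] at this
    have hlt' : w (α - (-α + s) / 2) * w (α - (-α - s) / 2) * w ((-α + s) / 2 - (-α - s) / 2) < 1 :=
      calc _ ≤ w (α - (-α + s) / 2) * 1 * 1 := by gcongr
        _ < 1 := by rw [mul_one, mul_one]; exact hlt
    exact absurd this hlt'.ne
  have hunit2 : w (α - (-α - s) / 2) = 1 := by
    by_contra hne
    have hlt : w (α - (-α - s) / 2) < 1 := lt_of_le_of_ne hd2 hne
    have := congrArg w hprod
    rw [Valuation.map_mul, Valuation.map_mul, hδw] at this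
    have hlt' : w (α - (-α + s) / 2) * w (α - (-α - s) / 2) * w ((-α + s) / 2 - (-α - s) / 2) < 1 :=
      calc _ ≤ 1 * w (α - (-α - s) / 2) * 1 := by gcongr
        _ < 1 := by rw [one_mul, mul_one]; exact hlt
    exact absurd this hlt'.ne
  -- inertia moves `α` within its residue class
  have hmove : w (τ • α - α) < 1 := (mem_inertia_iff_spectralValuation hw h𝔐).mp hτ α hαw
  rcases smul_cubicRoot_mem hα hδ τ with h | h | h
  · exact h
  · exfalso
    rw [h, ← Valuation.map_sub_swap] at hmove
    rw [hsdef] at hunit1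
    exact absurd hunit1 hmove.ne
  · exfalso
    rw [h, ← Valuation.map_sub_swap] at hmove
    rw [hsdef] at hunit2
    exact absurd hunit2 hmove.ne

end Inertia


/-! ## THEOREM A -/

section Main

variable (M : WeierstrassCurve (v.adicCompletionIntegers K))

include hw in
set_option maxHeartbeats 800000 in
/-- **THEOREM A (the unramified cubic twist of an identity-component `3`-torsion point is a
Kummer class).** `v ∣ 3`; `M` an integral model, elliptic over `K_v`, with cuspidal reduction
`singularModel x₀ y₀ a a`; `α³ = α + 1` with `X³ − X − 1` rootless in `K_v`, `−23 = δ²`;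
`F₀ ∈ Γ_{K_v}` moving `α`; `T = (a₀, b₀)` an integral point of `M` with nonsingular reduction and
`3 • T = O`. Then some `P ∈ V(K̄_v)` is fixed by `Stab(α)` and has `F₀ P − P = T`.
[cite: MilneADT2006, Ch. I Prop. 3.8 (proof)] [cite: SilvermanAEC2009, Prop. VII.2.1] -/
theorem exists_map_sub_eq_twist_of_identityComponent
    [hMell : (M.map (algebraMap (v.adicCompletionIntegers K) (v.adicCompletion K))).IsElliptic]
    (h3v : ((3 : ℕ) : 𝓞 K) ∈ v.asIdeal)
    (x₀ y₀ a : IsLocalRing.ResidueField (v.adicCompletionIntegers K))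
    (hcusp : M.map (IsLocalRing.residue (v.adicCompletionIntegers K)) = singularModel x₀ y₀ a a)
    {α : AlgebraicClosure (v.adicCompletion K)} (hα : α ^ 3 = α + 1) {δ : v.adicCompletion K} (hδ : δ ^ 2 = -23)
    (hnoroot : ∀ x : v.adicCompletion K, x ^ 3 - x - 1 ≠ 0)
    (F₀ : absoluteGaloisGroup (v.adicCompletion K)) (hF₀ : F₀ • α ≠ α)
    {a₀ b₀ : v.adicCompletionIntegers K}
    (hns₀ : (M.map (IsLocalRing.residue (v.adicCompletionIntegers K))).toAffine.Nonsingular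
      (IsLocalRing.residue (v.adicCompletionIntegers K) a₀) (IsLocalRing.residue (v.adicCompletionIntegers K) b₀))
    (hm : ((M.map (algebraMap (v.adicCompletionIntegers K) (v.adicCompletion K))).baseChange (AlgebraicClosure (v.adicCompletion K))).toAffine.Nonsingular
      (algebraMap (v.adicCompletionIntegers K) (AlgebraicClosure (v.adicCompletion K)) a₀) (algebraMap (v.adicCompletionIntegers K) (AlgebraicClosure (v.adicCompletion K)) b₀))
    (h3 : (3 : ℤ) • (Affine.Point.some _ _ hm : ((M.map (algebraMap (v.adicCompletionIntegers K) (v.adicCompletion K))).baseChange (AlgebraicClosure (v.adicCompletion K))).toAffine.Point) = 0) :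
    ∃ P : ((M.map (algebraMap (v.adicCompletionIntegers K) (v.adicCompletion K))).baseChange (AlgebraicClosure (v.adicCompletion K))).toAffine.Point,
      (∀ h : absoluteGaloisGroup (v.adicCompletion K), h • α = α →
        Affine.Point.map ((absoluteGaloisGroup.toAlgEquiv (v.adicCompletion K) (h) : AlgebraicClosure (v.adicCompletion K) ≃ₐ[v.adicCompletion K] AlgebraicClosure (v.adicCompletion K)) : AlgebraicClosure (v.adicCompletion K) →ₐ[v.adicCompletion K] AlgebraicClosure (v.adicCompletion K)) P = P) ∧
      Affine.Point.map ((absoluteGaloisGroup.toAlgEquiv (v.adicCompletion K) (F₀) : AlgebraicClosure (v.adicCompletion K) ≃ₐ[v.adicCompletion K] AlgebraicClosure (v.adicCompletion K)) : AlgebraicClosure (v.adicCompletion K) →ₐ[v.adicCompletion K] AlgebraicClosure (v.adicCompletion K)) P - P = Affine.Point.some _ _ hm := by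
  haveI : Fact (Nat.Prime 3) := ⟨Nat.prime_three⟩
  haveI : CharZero (v.adicCompletion K) := Literature.NumberTheory.GaloisRepresentations.charZero_adicCompletion v
  haveI := isIntegral_spectralValuation_baseChange hw M
  obtain ⟨𝔐, h𝔐⟩ := v.localPrimesAbove_nonempty
  -- the group `H = Stab(α)`, normal of index `3`, and the exponent function
  set H : Subgroup (absoluteGaloisGroup (v.adicCompletion K)) := MulAction.stabilizer (absoluteGaloisGroup (v.adicCompletion K)) α with hHdef
  haveI hHn : H.Normal := normal_stabilizer_cubicRoot hα hδ
  have hHi : H.index = 3 := index_stabilizer_cubicRoot hα hδ hnoroot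
  have hmemH : ∀ σ : absoluteGaloisGroup (v.adicCompletion K), σ ∈ H ↔ σ • α = α := fun σ ↦ MulAction.mem_stabilizer_iff
  have hF₀H : F₀ ∉ H := fun h ↦ hF₀ ((hmemH F₀).mp h)
  have hF3 : F₀ ^ 3 ∈ H := by rw [← hHi]; exact Subgroup.pow_index_mem H F₀
  -- `F₀ ^ z ∈ H → 3 ∣ z`
  have hzpow : ∀ z : ℤ, F₀ ^ z ∈ H → (3 : ℤ) ∣ z := by
    intro z hz
    have hz3 : 3 * (z / 3) + z % 3 = z := by omega
    have hq : F₀ ^ z = (F₀ ^ (3 : ℕ)) ^ (z / 3) * F₀ ^ (z % 3) := by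
      conv_rhs => rw [← zpow_natCast, ← zpow_mul, ← zpow_add, Nat.cast_ofNat, hz3]
    have hr : F₀ ^ (z % 3) ∈ H := by
      have h1 : (F₀ ^ (3 : ℕ)) ^ (z / 3) ∈ H := H.zpow_mem hF3 _
      have := H.mul_mem (H.inv_mem h1) hz
      rwa [hq, ← mul_assoc, inv_mul_cancel, one_mul] at this
    have hlt : z % 3 < 3 := Int.emod_lt_of_pos z (by norm_num)
    have hge : 0 ≤ z % 3 := Int.emod_nonneg z (by norm_num)
    rcases (show z % 3 = 0 ∨ z % 3 = 1 ∨ z % 3 = 2 by omega) with h0 | h1 | h2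
    · exact Int.dvd_of_emod_eq_zero h0
    · exfalso; rw [h1, zpow_one] at hr; exact hF₀H hr
    · exfalso
      rw [h2] at hr
      have : F₀ = F₀ ^ (3 : ℕ) * (F₀ ^ (2 : ℤ))⁻¹ := by group
      exact hF₀H (this ▸ H.mul_mem hF3 (H.inv_mem hr))
  have hgen := exists_pow_mul_of_index_eq_prime H hHi hF₀H
  choose i hσ hhσ heq using hgen
  -- exponents are additive modulo `3`
  have hiadd : ∀ σ τ : absoluteGaloisGroup (v.adicCompletion K),
      (3 : ℤ) ∣ ((i (σ * τ) : ℤ) - (i σ + i τ)) := by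
    intro σ τ
    apply hzpow
    have eσ := heq σ
    have eτ := heq τ
    have est := heq (σ * τ)
    have hs := hhσ σ
    have ht := hhσ τ
    have hst := hhσ (σ * τ)
    generalize i σ = a, i τ = b, i (σ * τ) = c, hσ σ = s, hσ τ = t, hσ (σ * τ) = u
      at eσ eτ est hs ht hst ⊢
    rw [eσ, eτ] at est
    have hc : F₀ ^ (c : ℤ) = F₀ ^ (a : ℤ) * s * (F₀ ^ (b : ℤ) * t) * u⁻¹ := by
      rw [eq_mul_inv_iff_mul_eq, zpow_natCast, zpow_natCast, zpow_natCast]; exact est.symm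
    have key : F₀ ^ ((c : ℤ) - (a + b)) =
        F₀ ^ (a : ℤ) * (s * (F₀ ^ (b : ℤ) * (t * u⁻¹) * (F₀ ^ (b : ℤ))⁻¹)) * (F₀ ^ (a : ℤ))⁻¹ := by
      rw [zpow_sub, hc]; group
    rw [key]
    refine hHn.conj_mem _ ?_ _
    exact H.mul_mem hs (hHn.conj_mem _ (H.mul_mem ht (H.inv_mem hst)) _)
  have hiH : ∀ σ : absoluteGaloisGroup (v.adicCompletion K), σ ∈ H → (3 : ℤ) ∣ (i σ : ℤ) := by
    intro σ hσH
    apply hzpow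
    have e : F₀ ^ (i σ) = σ * (hσ σ)⁻¹ := by rw [eq_mul_inv_iff_mul_eq]; exact (heq σ).symm
    rw [zpow_natCast, e]
    exact H.mul_mem hσH (H.inv_mem (hhσ σ))
  have hiF₀ : (3 : ℤ) ∣ ((i F₀ : ℤ) - 1) := by
    apply hzpow
    have e : F₀ ^ (i F₀) = F₀ * (hσ F₀)⁻¹ := by rw [eq_mul_inv_iff_mul_eq]; exact (heq F₀).symm
    rw [zpow_sub, zpow_one, zpow_natCast, e]
    exact hHn.conj_mem _ (H.inv_mem (hhσ F₀)) F₀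
  -- `H` is open (it contains the fixing subgroup of the finite extension `K_v(α)`)
  have hαint : IsIntegral (v.adicCompletion K) α := by
    refine ⟨X ^ 3 - X - 1, by monicity!, ?_⟩
    simp only [eval₂_sub, eval₂_X_pow, eval₂_X, eval₂_one]
    rw [hα]; ring
  have hHopen : IsOpen (H : Set (absoluteGaloisGroup (v.adicCompletion K))) := by
    apply Subgroup.isOpen_of_mem_nhds H (g := 1)
    haveI := IntermediateField.adjoin.finiteDimensional hαint
    refine (krullTopology_mem_nhds_one_iff (v.adicCompletion K) (AlgebraicClosure (v.adicCompletion K)) _).mpr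
      ⟨IntermediateField.adjoin (v.adicCompletion K) {α}, inferInstance, fun σ hσ ↦ ?_⟩
    exact (hmemH σ).mpr ((IntermediateField.mem_fixingSubgroup_iff _ _).mp hσ α
      (IntermediateField.mem_adjoin_simple_self (v.adicCompletion K) α))
  -- the point `T` (fixed by `Γ_{K_v}`, of order `3`) and the crossed homomorphism `g σ = i σ • T`
  set T : ((M.map (algebraMap (v.adicCompletionIntegers K) (v.adicCompletion K))).baseChange (AlgebraicClosure (v.adicCompletion K))).toAffine.Point := Affine.Point.some _ _ hm with hTdef
  have hTfix : ∀ σ : absoluteGaloisGroup (v.adicCompletion K), Affine.Point.map ((absoluteGaloisGroup.toAlgEquiv (v.adicCompletion K) (σ) : AlgebraicClosure (v.adicCompletion K) ≃ₐ[v.adicCompletion K] AlgebraicClosure (v.adicCompletion K)) : AlgebraicClosure (v.adicCompletion K) →ₐ[v.adicCompletion K] AlgebraicClosure (v.adicCompletion K)) T = T := by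
    intro σ
    rw [hTdef, Affine.Point.map_some]
    refine point_some_eq_some ?_ ?_
    · change absoluteGaloisGroup.toAlgEquiv (v.adicCompletion K) σ (algebraMap (v.adicCompletionIntegers K) (AlgebraicClosure (v.adicCompletion K)) a₀) = _
      rw [IsScalarTower.algebraMap_apply (v.adicCompletionIntegers K) (v.adicCompletion K) (AlgebraicClosure (v.adicCompletion K))]
      exact AlgEquiv.commutes _ _
    · change absoluteGaloisGroup.toAlgEquiv (v.adicCompletion K) σ (algebraMap (v.adicCompletionIntegers K) (AlgebraicClosure (v.adicCompletion K)) b₀) = _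
      rw [IsScalarTower.algebraMap_apply (v.adicCompletionIntegers K) (v.adicCompletion K) (AlgebraicClosure (v.adicCompletion K))]
      exact AlgEquiv.commutes _ _
  have hT0 : T ≠ 0 := Affine.Point.some_ne_zero _
  have hzsmul3 : ∀ m n : ℤ, (3 : ℤ) ∣ (m - n) → m • T = n • T := by
    rintro m n ⟨k, hk⟩
    have e : m = n + k * 3 := by linarith
    rw [e, add_zsmul, mul_zsmul, h3, zsmul_zero, add_zero]
  have hTord : ∀ n : ℤ, n • T = 0 → (3 : ℤ) ∣ n := by
    intro n hn
    have hr : (n % 3) • T = 0 := by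
      rw [← hn]; exact hzsmul3 _ _ (by omega)
    rcases (show n % 3 = 0 ∨ n % 3 = 1 ∨ n % 3 = 2 by omega) with h0 | h1 | h2
    · exact Int.dvd_of_emod_eq_zero h0
    · exfalso; rw [h1, one_zsmul] at hr; exact hT0 hr
    · exfalso
      rw [h2] at hr
      apply hT0
      calc T = (1 : ℤ) • T := (one_zsmul T).symm
        _ = ((3 : ℤ) - 2) • T := by norm_num
        _ = (3 : ℤ) • T - (2 : ℤ) • T := sub_zsmul T 3 2
        _ = 0 := by rw [h3, hr, sub_zero]
  -- the crossed homomorphism `g σ = i σ • T`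
  set g : absoluteGaloisGroup (v.adicCompletion K) → ((M.map (algebraMap (v.adicCompletionIntegers K) (v.adicCompletion K))).baseChange (AlgebraicClosure (v.adicCompletion K))).toAffine.Point := fun σ ↦ (i σ : ℤ) • T with hgdef
  have hg : ∀ σ τ, g (σ * τ) = g σ + Affine.Point.map ((absoluteGaloisGroup.toAlgEquiv (v.adicCompletion K) (σ) : AlgebraicClosure (v.adicCompletion K) ≃ₐ[v.adicCompletion K] AlgebraicClosure (v.adicCompletion K)) : AlgebraicClosure (v.adicCompletion K) →ₐ[v.adicCompletion K] AlgebraicClosure (v.adicCompletion K)) (g τ) := by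
    intro σ τ
    simp only [hgdef]
    rw [map_zsmul, hTfix, ← add_zsmul]
    exact hzsmul3 _ _ (hiadd σ τ)
  have hg0 : ∀ σ, g σ = 0 ↔ σ ∈ H := by
    intro σ
    simp only [hgdef]
    constructor
    · intro h0
      have hd := hTord _ h0
      -- `σ = F₀^{iσ} h` with `3 ∣ iσ`
      rw [heq σ]
      refine H.mul_mem ?_ (hhσ σ)
      obtain ⟨k, hk⟩ := hd
      have : F₀ ^ (i σ) = (F₀ ^ (3 : ℕ)) ^ k := by
        rw [← zpow_natCast, hk, zpow_mul]; norm_cast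
      rw [this]
      exact H.zpow_mem hF3 k
    · intro hσH
      rw [hzsmul3 _ 0 (by simpa using hiH σ hσH), zero_zsmul]
  have hopen : IsOpen {σ | g σ = 0} := by
    have e : {σ | g σ = 0} = (H : Set (absoluteGaloisGroup (v.adicCompletion K))) := Set.ext fun σ ↦ hg0 σ
    rw [e]; exact hHopen
  have hI : ∀ τ ∈ 𝔐.inertia (absoluteGaloisGroup (v.adicCompletion K)), g τ = 0 := fun τ hτ ↦
    (hg0 τ).mpr ((hmemH τ).mpr (smul_cubicRoot_eq_of_mem_inertia hw h3v h𝔐 hα hδ hτ))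
  -- the values of `g` are `O`, `T`, `−T`: images of `E₀(K_v)`-points
  have hnegY : ((M.map (algebraMap (v.adicCompletionIntegers K) (v.adicCompletion K))).baseChange (AlgebraicClosure (v.adicCompletion K))).toAffine.negY
      (algebraMap (v.adicCompletionIntegers K) (AlgebraicClosure (v.adicCompletion K)) a₀) (algebraMap (v.adicCompletionIntegers K) (AlgebraicClosure (v.adicCompletion K)) b₀) =
      algebraMap (v.adicCompletionIntegers K) (AlgebraicClosure (v.adicCompletion K)) (M.toAffine.negY a₀ b₀) := by
    simp only [Affine.negY, baseChange, map_a₁, map_a₃, map_sub, map_neg, map_mul,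
      ← IsScalarTower.algebraMap_apply]
  have hm' : ((M.map (algebraMap (v.adicCompletionIntegers K) (v.adicCompletion K))).baseChange (AlgebraicClosure (v.adicCompletion K))).toAffine.Nonsingular
      (algebraMap (v.adicCompletionIntegers K) (AlgebraicClosure (v.adicCompletion K)) a₀) (algebraMap (v.adicCompletionIntegers K) (AlgebraicClosure (v.adicCompletion K)) (M.toAffine.negY a₀ b₀)) := by
    rw [← hnegY]; exact (Affine.nonsingular_neg _ _).mpr hm
  have hns' : (M.map (IsLocalRing.residue (v.adicCompletionIntegers K))).toAffine.Nonsingular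
      (IsLocalRing.residue (v.adicCompletionIntegers K) a₀) (IsLocalRing.residue (v.adicCompletionIntegers K) (M.toAffine.negY a₀ b₀)) := by
    rw [← map_residue_negY]; exact (Affine.nonsingular_neg _ _).mpr hns₀
  have hnegT : -T = Affine.Point.some _ _ hm' := by
    rw [hTdef, Affine.Point.neg_some]
    exact point_some_eq_some rfl hnegY
  have h2T : (2 : ℤ) • T = -T := by
    rw [eq_neg_iff_add_eq_zero, ← add_one_zsmul]
    exact h3
  have hgE0 : ∀ σ, g σ = 0 ∨ ∃ (a₁ b₁ : v.adicCompletionIntegers K)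
      (_ : (M.map (IsLocalRing.residue (v.adicCompletionIntegers K))).toAffine.Nonsingular
        (IsLocalRing.residue (v.adicCompletionIntegers K) a₁) (IsLocalRing.residue (v.adicCompletionIntegers K) b₁))
      (hm₁ : ((M.map (algebraMap (v.adicCompletionIntegers K) (v.adicCompletion K))).baseChange (AlgebraicClosure (v.adicCompletion K))).toAffine.Nonsingular
        (algebraMap (v.adicCompletionIntegers K) (AlgebraicClosure (v.adicCompletion K)) a₁) (algebraMap (v.adicCompletionIntegers K) (AlgebraicClosure (v.adicCompletion K)) b₁)),
      g σ = .some _ _ hm₁ := by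
    intro σ
    have hr : g σ = ((i σ : ℤ) % 3) • T := by
      simp only [hgdef]; exact hzsmul3 _ _ (by omega)
    rcases (show (i σ : ℤ) % 3 = 0 ∨ (i σ : ℤ) % 3 = 1 ∨ (i σ : ℤ) % 3 = 2 by omega) with h0 | h1 | h2
    · left; rw [hr, h0, zero_zsmul]
    · right; exact ⟨a₀, b₀, hns₀, hm, by rw [hr, h1, one_zsmul]⟩
    · right; exact ⟨a₀, M.toAffine.negY a₀ b₀, hns', hm', by rw [hr, h2, h2T, hnegT]⟩
  -- FILE 7c: `g` is principal
  obtain ⟨P, hP⟩ := exists_eq_map_sub_of_cocycle_of_cusp M hw x₀ y₀ a hcusp h𝔐 g hg hopen hI hgE0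
  refine ⟨P, fun h hh ↦ ?_, ?_⟩
  · have := hP h
    rw [(hg0 h).mpr ((hmemH h).mpr hh), eq_comm, sub_eq_zero] at this
    exact this
  · rw [← hP F₀]
    simp only [hgdef]
    rw [hzsmul3 _ 1 hiF₀, one_zsmul]

end Main

end Summit.BirchSwinnertonDyer.Rank1Residual.GaloisImage.TwistedWitness

end
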